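import Summits.QuantumFields.QCD.Theses.IntegerCriticalLine
import HarnessLib

/-!
# Route `IntegerCriticalLine` (QCD): the assembly item (stmt-QuantumFields-9696) holds

The route's assembly item is, arrow for arrow, its own kernel-checked deciding theorem
`Summit.QuantumFields.QCD.Theses.IntegerCriticalLine.closes`: pure logic, stated here BY NAME so that the ledger item closes.
The cruxes of the route remain exactly as open as they were; no summit, leg or crux statement is proved
(width seat ym-t4-w17 g0, free hands).
-/

set_option autoImplicit false

namespace Summit.QuantumFields.QCD.Theorems

/-- **Item stmt-QuantumFields-9696 `IntegerCriticalLine.Assembly` holds** — it is the route's deciding theorem `closes`. [folklore] -/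
theorem integerCriticalLine_assembly_proof :
    Summit.QuantumFields.QCD.Theses.IntegerCriticalLine.Assembly :=
  Summit.QuantumFields.QCD.Theses.IntegerCriticalLine.closes

end Summit.QuantumFields.QCD.Theorems
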